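import Summits.AtomisticToContinuum.FouriersLaw.Theorems.EmbeddedDrudeMourreAbelThermodynamicLimitAnchoredCorrelationTailsPropagation
import Summits.AtomisticToContinuum.FouriersLaw.Theorems.EmbeddedDrudeMourreAbelThermodynamicLimitAnchoredCorrelationTailsBadEvent

/-!
# Leaf (C) `stub_anchoredCorrelationTails`, part 5: the `N`-uniform single-flip estimate
(crux `EmbeddedDrudeMourre.AbelThermodynamicLimit`, item stmt-AtomisticToContinuum-12596, line
`loomis-compact-horizon-witness`; `--supports` file proving the registered sub-goal `stub_coneSingleFlipEstimate`)

For ONE flipped momentum `i₀` and a genuine bond `(k, k+1)` whose sites are at distance `D`, `D+1` from `i₀`, box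
scale `R ≥ 1` in the regime `12e · 2AR² · t ≤ D`, the pathwise mean square of the far current's difference along the
two synchronously coupled flows is `≤ (448(1+β)R³2^{-D})²(195T² + 32) + 4√(C₄ b)`, `b = O(D R⁻¹⁶)` the failure
probability of part 4 — the tree's `FSAssembly.single_flip_estimate` with its uniform box replaced by the growing boxes
(kinematics `pinnedChain_chainFlow_position_sq_le`, propagation of part 2, local Lipschitz bound of the current
`FSAssembly.abs_bondCurrent_sub_le` at radius `2R`, good/bad splitting with `FSAssembly.lintegral_weight_le`,
`…lintegral_current_four_le`, `…measure_bad_le`).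
-/

noncomputable section

namespace Summit.AtomisticToContinuum.FouriersLaw.Theorems.AbelThermodynamicLimit.LoomisCompactHorizonWitness

open MeasureTheory ProbabilityTheory Set Filter Topology
open scoped NNReal ENNReal
open Literature.MathematicalPhysics.KineticTheory Literature.MathematicalPhysics.KineticTheory.HeatConduction
open Literature.Probability.Process OscillatorChain
open Summit.AtomisticToContinuum.FouriersLaw.Theorems.NonBallistic
open Summit.AtomisticToContinuum.FouriersLaw.Theorems.NonBallistic.LightConePropagation
open Summit.AtomisticToContinuum.FouriersLaw.Theorems.PhononMeanFreePath (commonPastBound_gibbsEvenMoments)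
open Summit.AtomisticToContinuum.FouriersLaw.Theorems.SubdiffusiveBondHeat
open Summit.AtomisticToContinuum.FouriersLaw.Theorems.ChainVariation

/-! ### §3 The single-flip estimate with distance-growing boxes -/

section SingleFlip

variable {ω₂ lam β γ : ℝ} (hω : 0 < ω₂) (hl : 0 < lam) (hβ : 0 < β) (hγ : 0 < γ) {N : ℕ} {T : ℝ} (hT : 0 < T)

set_option maxHeartbeats 1600000 in
include hω hl hβ hγ hT in
/-- **The single-flip estimate, `N`-uniform form.** For ONE flipped momentum `i₀` and a genuine bond `(k, k+1)` whose two
sites are at distance `D` or `D + 1` from `i₀` (`D ≥ 1`), box scale `R ≥ 1` in the regime `12e · (2AR²) · t ≤ D` and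
`s ≤ t`, the pathwise mean square of the difference of the far current along the two synchronously coupled flows is

  `∫⁻∫⁻ (j_k(Φ_s(Θ_{i₀}x)) − j_k(Φ_s x))² dW dμ_T ≤ (448(1+β)R³2^{−D})²(195T² + 32) + 4√(C₄ b)`,

`b = 7D · 4⁸R⁻¹⁶ (κ₁₆ + 2 · 2027025 T⁸ t¹⁶)` the failure probability of the growing boxes (part 2), `C₄ ≥ ∫ j_k⁴ dμ_T`.
On the good event: kinematics (`pinnedChain_chainFlow_position_sq_le`) puts every position in its growing box, the
weighted propagation bound (`chainFlow_momentumFlip_propagation_weighted`) and the local Lipschitz bound of the current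
(`FSAssembly.abs_bondCurrent_sub_le`, radius `2R`) give `Δ² ≤ d(p_{i₀}⁴/2 + (1+|p_k|+|p_{k+1}|)⁴/2)`; off it,
`Δ² ≤ 2j̃² + 2j²` and Hölder (`FSAssembly.lintegral_weight_le`, `…lintegral_current_four_le`, `…measure_bad_le`). [folklore] -/
theorem single_flip_estimate_cone (i₀ k : Fin N) (hk : k.val + 1 < N) {D : ℕ} (hD : 1 ≤ D)
    (hDk : D ≤ ((k : ℤ) - (i₀ : ℤ)).natAbs) (hDk' : ((k : ℤ) - (i₀ : ℤ)).natAbs ≤ D + 1)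
    (hDk1 : D ≤ ((k : ℤ) + 1 - (i₀ : ℤ)).natAbs) (hDk1' : ((k : ℤ) + 1 - (i₀ : ℤ)).natAbs ≤ D + 1)
    {R t C₄ : ℝ} (hR : 1 ≤ R) (ht : 0 ≤ t) (hC₄ : 0 ≤ C₄)
    (hreg : 12 * Real.exp 1 * (2 * ((3 + ω₂ + 3 * lam + 24 * β + 2 * γ) * R ^ 2)) * t ≤ D)
    (hD2 : Integrable (fun x => (pinnedChain ω₂ lam β γ).bondCurrent N k x ^ 4)
        ((pinnedChain ω₂ lam β γ).gibbsMeasure N T) ∧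
      ∫ x, (pinnedChain ω₂ lam β γ).bondCurrent N k x ^ 4 ∂((pinnedChain ω₂ lam β γ).gibbsMeasure N T) ≤ C₄)
    (s : ℝ≥0) (hs : (s : ℝ) ≤ t) :
    ∫⁻ x, ∫⁻ ω, ENNReal.ofReal
        (((pinnedChain ω₂ lam β γ).bondCurrent N k
            ((pinnedChain ω₂ lam β γ).solMap N T T s (momentumFlip i₀ x) (pairPath ω)) -
          (pinnedChain ω₂ lam β γ).bondCurrent N k
            ((pinnedChain ω₂ lam β γ).solMap N T T s x (pairPath ω))) ^ 2)
        ∂wienerPair ∂((pinnedChain ω₂ lam β γ).gibbsMeasure N T) ≤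
      ENNReal.ofReal ((448 * (1 + β) * R ^ 3 * (1 / 2) ^ D) ^ 2 * (195 * T ^ 2 + 32)) +
        ENNReal.ofReal (4 * Real.sqrt (C₄ *
          (7 * D * (((∫⁻ a, ENNReal.ofReal (a ^ 16) *
                ENNReal.ofReal (Real.exp (-(pinnedChain ω₂ lam β γ).U a / T))) /
              ∫⁻ a, ENNReal.ofReal (Real.exp (-(pinnedChain ω₂ lam β γ).U a / T))).toReal * 4 ^ 8 / R ^ 16) +
            2 * (7 * D * (2027025 * T ^ 8 * 4 ^ 8 * t ^ 16 / R ^ 16))))) := by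
  -- adapted from `FSAssembly.single_flip_estimate` (…NonBallisticLightConeAssemblyPart2e): uniform box `|q| ≤ R_N`
  -- replaced by the distance-growing boxes `q_j² ≤ R² max(1, |j - i₀|/D)`
  set P := pinnedChain ω₂ lam β γ with hP
  set μ := P.gibbsMeasure N T with hμ
  haveI hμP : IsProbabilityMeasure μ := pinnedChain_isProbabilityMeasure_gibbsMeasure hω hl.le hβ.le γ N hT
  have hN0 : 0 < N := by omega
  set k1 : Fin N := ⟨k.val + 1, hk⟩ with hk1
  have hk1z : ((k1 : ℤ) - (i₀ : ℤ)) = (k : ℤ) + 1 - (i₀ : ℤ) := by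
    simp only [hk1]; push_cast; ring
  set d : ℝ := (448 * (1 + β) * R ^ 3 * (1 / 2) ^ D) ^ 2 with hd
  have hd0 : 0 ≤ d := sq_nonneg _
  have hR0 : 0 ≤ R := zero_le_one.trans hR
  have hRpos : 0 < R := lt_of_lt_of_le one_pos hR
  have h2R : 1 ≤ 2 * R := by linarith
  set κr : ℝ := (((∫⁻ a, ENNReal.ofReal (a ^ 16) * ENNReal.ofReal (Real.exp (-P.U a / T))) /
      ∫⁻ a, ENNReal.ofReal (Real.exp (-P.U a / T))).toReal) with hκr
  have hκr0 : 0 ≤ κr := ENNReal.toReal_nonneg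
  set b₁ : ℝ := 7 * D * (κr * 4 ^ 8 / R ^ 16) with hb₁
  set b₂ : ℝ := 7 * D * (2027025 * T ^ 8 * 4 ^ 8 * t ^ 16 / R ^ 16) with hb₂
  have hb₁0 : 0 ≤ b₁ := by positivity
  have hb₂0 : 0 ≤ b₂ := by positivity
  -- the weight
  set g : Fin N → ℝ := fun j => max 1 ((((j : ℤ) - (i₀ : ℤ)).natAbs : ℝ) / D) with hg
  have hg1 : ∀ j, 1 ≤ g j := fun j => le_max_left _ _
  have hD0 : (0:ℝ) < D := by exact_mod_cast hD
  have hgk : g k ≤ 2 := by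
    simp only [hg]
    refine max_le (by norm_num) ?_
    rw [div_le_iff₀ hD0]
    have : (((k : ℤ) - (i₀ : ℤ)).natAbs : ℝ) ≤ D + 1 := by exact_mod_cast hDk'
    have hD1 : (1:ℝ) ≤ D := by exact_mod_cast hD
    linarith
  have hgk1 : g k1 ≤ 2 := by
    simp only [hg, hk1z]
    refine max_le (by norm_num) ?_
    rw [div_le_iff₀ hD0]
    have : (((k : ℤ) + 1 - (i₀ : ℤ)).natAbs : ℝ) ≤ D + 1 := by exact_mod_cast hDk1'
    have hD1 : (1:ℝ) ≤ D := by exact_mod_cast hD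
    linarith
  have hDk1'' : D ≤ ((k1 : ℤ) - (i₀ : ℤ)).natAbs := by rw [hk1z]; exact hDk1
  -- measurability of the two flows at time s, jointly in (x, ω)
  have hzm : Measurable fun q : PhaseSpace N × WienerPair => P.solMap N T T s q.1 (pairPath q.2) :=
    pinnedChain_measurable_solMap_pairPath hω hl.le hβ.le hγ.le N T T s
  set Θ : PhaseSpace N × WienerPair → PhaseSpace N × WienerPair := fun q => (momentumFlip i₀ q.1, q.2) with hΘ
  have hΘm : Measurable Θ := ((measurable_momentumFlip i₀).comp measurable_fst).prodMk measurable_snd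
  have hz'm : Measurable fun q : PhaseSpace N × WienerPair =>
      P.solMap N T T s (momentumFlip i₀ q.1) (pairPath q.2) := by
    have h := hzm.comp hΘm
    exact h
  have hjc : Continuous (P.bondCurrent N k) := pinnedChain_continuous_bondCurrent ω₂ lam β γ N k
  have hjm : Measurable (P.bondCurrent N k) := hjc.measurable
  set J : PhaseSpace N × WienerPair → ℝ := fun q => P.bondCurrent N k (P.solMap N T T s q.1 (pairPath q.2)) with hJ
  set J' : PhaseSpace N × WienerPair → ℝ := fun q =>
    P.bondCurrent N k (P.solMap N T T s (momentumFlip i₀ q.1) (pairPath q.2)) with hJ'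
  have hJm : Measurable J := by
    have h := hjm.comp hzm
    exact h
  have hJ'm : Measurable J' := by
    have h := hjm.comp hz'm
    exact h
  set g₂ : PhaseSpace N → ℝ := fun z => (1 + |z.2 k| + |z.2 k1|) ^ 4 / 2 with hg₂
  have hg₂m : Measurable g₂ := by
    have h1 : Measurable fun z : PhaseSpace N => z.2 k := (measurable_pi_apply k).comp measurable_snd
    have h2 : Measurable fun z : PhaseSpace N => z.2 k1 := (measurable_pi_apply k1).comp measurable_snd
    exact (((measurable_const.add h1.abs).add h2.abs).pow_const 4).div_const 2
  set g₁ : PhaseSpace N → ℝ := fun x => (x.2 i₀) ^ 4 / 2 with hg₁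
  have hg₁m : Measurable g₁ := (((measurable_pi_apply i₀).comp measurable_snd).pow_const 4).div_const 2
  -- the bad event of the growing boxes
  set B₁ : Set (PhaseSpace N) := {x | ∃ j : Fin N, R ^ 2 * max 1 ((((j : ℤ) - (i₀ : ℤ)).natAbs : ℝ) / D) / 4 < x.1 j ^ 2}
    with hB₁def
  set E : Set (PhaseSpace N × WienerPair) := {q | ∃ j : Fin N,
      R ^ 2 * max 1 ((((j : ℤ) - (i₀ : ℤ)).natAbs : ℝ) / D) / 2 <
        2 * t * ∫ r in (0:ℝ)..t, (P.solMap N T T r q.1 (pairPath q.2)).2 j ^ 2} with hEdef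
  obtain ⟨hB₁m, hEm⟩ : MeasurableSet B₁ ∧ MeasurableSet E :=
    measurableSet_coneBad hω hl.le hβ.le hγ.le (N := N) (T := T) i₀ R t D
  set BAD : Set (PhaseSpace N × WienerPair) := (Prod.fst ⁻¹' B₁ ∪ E) ∪ Θ ⁻¹' E with hBAD
  have hBADm : MeasurableSet BAD := ((measurable_fst hB₁m).union hEm).union (hΘm hEm)
  -- the integrand and its two majorants
  set F : PhaseSpace N × WienerPair → ℝ≥0∞ := fun q => ENNReal.ofReal ((J' q - J q) ^ 2) with hF
  set G₁ : PhaseSpace N × WienerPair → ℝ≥0∞ := fun q =>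
    ENNReal.ofReal (d * g₁ q.1) + ENNReal.ofReal (d * g₂ (P.solMap N T T s q.1 (pairPath q.2))) with hG₁
  set G₂ : PhaseSpace N × WienerPair → ℝ≥0∞ := fun q =>
    2 * (BAD.indicator (fun _ => (1 : ℝ≥0∞)) q * ENNReal.ofReal (J' q ^ 2)) +
      2 * (BAD.indicator (fun _ => (1 : ℝ≥0∞)) q * ENNReal.ofReal (J q ^ 2)) with hG₂
  have hFm : Measurable F := ENNReal.measurable_ofReal.comp ((hJ'm.sub hJm).pow_const 2)
  have hg₂zm : Measurable fun q : PhaseSpace N × WienerPair => g₂ (P.solMap N T T s q.1 (pairPath q.2)) := by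
    have h := hg₂m.comp hzm
    exact h
  have hG₁m : Measurable G₁ :=
    (ENNReal.measurable_ofReal.comp (measurable_const.mul (hg₁m.comp measurable_fst))).add
      (ENNReal.measurable_ofReal.comp (measurable_const.mul hg₂zm))
  have hindm : Measurable (BAD.indicator fun _ => (1 : ℝ≥0∞)) := measurable_const.indicator hBADm
  have hG₂m : Measurable G₂ :=
    (measurable_const.mul (hindm.mul (ENNReal.measurable_ofReal.comp (hJ'm.pow_const 2)))).add
      (measurable_const.mul (hindm.mul (ENNReal.measurable_ofReal.comp (hJm.pow_const 2))))
  ------------------------------------------------------------------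
  -- Step 1: pointwise domination `F ≤ G₁ + G₂`
  ------------------------------------------------------------------
  have hdom : ∀ q, F q ≤ G₁ q + G₂ q := by
    rintro ⟨x, ω⟩
    by_cases hq : (x, ω) ∈ BAD
    · -- on the bad event: (a - b)² ≤ 2a² + 2b²
      have h1 : F (x, ω) ≤ G₂ (x, ω) := by
        simp only [hF, hG₂, Set.indicator_of_mem hq, one_mul]
        have e : (J' (x, ω) - J (x, ω)) ^ 2 ≤ 2 * J' (x, ω) ^ 2 + 2 * J (x, ω) ^ 2 := by
          nlinarith [sq_nonneg (J' (x, ω) + J (x, ω))]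
        calc ENNReal.ofReal ((J' (x, ω) - J (x, ω)) ^ 2)
            ≤ ENNReal.ofReal (2 * J' (x, ω) ^ 2 + 2 * J (x, ω) ^ 2) := ENNReal.ofReal_le_ofReal e
          _ = 2 * ENNReal.ofReal (J' (x, ω) ^ 2) + 2 * ENNReal.ofReal (J (x, ω) ^ 2) := by
              rw [ENNReal.ofReal_add (by positivity) (by positivity), ENNReal.ofReal_mul (by norm_num),
                ENNReal.ofReal_mul (by norm_num), ENNReal.ofReal_ofNat]
      exact h1.trans le_add_self
    · -- on the good event: the cone bound
      have hxB : ∀ j : Fin N, x.1 j ^ 2 ≤ R ^ 2 * g j / 4 := by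
        intro j
        by_contra h
        exact hq (Or.inl (Or.inl ⟨j, lt_of_not_ge h⟩))
      have hxE : (x, ω) ∉ E := fun h => hq (Or.inl (Or.inr h))
      have hx'E : (momentumFlip i₀ x, ω) ∉ E := fun h => hq (Or.inr (show Θ (x, ω) ∈ E from h))
      set η : ℝ → Fin N → ℝ := P.pairNoise N T T (pairPath ω) with hη
      have hηc : Continuous η := P.continuous_pairNoise N T T (pairPath ω)
      have hsol : ∀ (y : PhaseSpace N) (u : ℝ), P.solMap N T T u y (pairPath ω) = P.chainFlow N y η u :=
        fun _ _ => rfl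
      -- positions of a flow started at `y ∈ {x, Θx}` with `(y, ω) ∉ E` stay in the growing boxes
      have hposy : ∀ y : PhaseSpace N, (∀ j : Fin N, y.1 j ^ 2 ≤ R ^ 2 * g j / 4) → (y, ω) ∉ E →
          ∀ r ∈ Icc 0 t, ∀ j : Fin N, (P.chainFlow N y η r).1 j ^ 2 ≤ R ^ 2 * g j := by
        intro y hy hyE r hr j
        have hkin := (pinnedChain_chainFlow_position_sq_le ω₂ lam β γ hω hl.le hβ.le hγ.le N y η hηc t r hr j).2
        have hmom : 2 * t * ∫ u in (0:ℝ)..t, ((P.chainFlow N y η u).2 j) ^ 2 ≤ R ^ 2 * g j / 2 := by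
          by_contra h
          exact hyE ⟨j, lt_of_not_ge h⟩
        rw [hP] at hmom
        have hy' := hy j
        linarith
      have hbox : ∀ r ∈ Set.Icc 0 t, ∀ j : Fin N,
          (P.chainFlow N x η r).1 j ^ 2 ≤ R ^ 2 * max 1 ((((j : ℤ) - (i₀ : ℤ)).natAbs : ℝ) / D) ∧
          (P.chainFlow N (momentumFlip i₀ x) η r).1 j ^ 2 ≤ R ^ 2 * max 1 ((((j : ℤ) - (i₀ : ℤ)).natAbs : ℝ) / D) :=
        fun r hr j => ⟨hposy x hxB hxE r hr j,
          hposy (momentumFlip i₀ x) (fun j => by rw [momentumFlip_fst]; exact hxB j) hx'E r hr j⟩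
      have hsI : (s : ℝ) ∈ Set.Icc 0 t := ⟨s.2, hs⟩
      -- box on [0, s] and the regime at time s
      have hboxs : ∀ r ∈ Set.Icc 0 (s : ℝ), ∀ j : Fin N,
          (P.chainFlow N x η r).1 j ^ 2 ≤ R ^ 2 * max 1 ((((j : ℤ) - (i₀ : ℤ)).natAbs : ℝ) / D) ∧
          (P.chainFlow N (momentumFlip i₀ x) η r).1 j ^ 2 ≤ R ^ 2 * max 1 ((((j : ℤ) - (i₀ : ℤ)).natAbs : ℝ) / D) :=
        fun r hr j => hbox r ⟨hr.1, hr.2.trans hs⟩ j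
      have hregs : 12 * Real.exp 1 * (2 * ((3 + ω₂ + 3 * lam + 24 * β + 2 * γ) * R ^ 2)) * s ≤ D := by
        have h0 : 0 ≤ 12 * Real.exp 1 * (2 * ((3 + ω₂ + 3 * lam + 24 * β + 2 * γ) * R ^ 2)) := by positivity
        exact (mul_le_mul_of_nonneg_left hs h0).trans hreg
      -- the propagation bound at the two bond sites
      have huk := chainFlow_momentumFlip_propagation_weighted hω hl.le hβ.le hγ.le N i₀ x hηc hR s.2 hD hboxs hregs
        (k := k) hDk
      have huk1 := chainFlow_momentumFlip_propagation_weighted hω hl.le hβ.le hγ.le N i₀ x hηc hR s.2 hD hboxs hregs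
        (k := k1) hDk1''
      rw [← hP] at huk huk1
      set z : PhaseSpace N := P.chainFlow N x η s with hz
      set z' : PhaseSpace N := P.chainFlow N (momentumFlip i₀ x) η s with hz'
      -- positions at the bond are bounded by `2R`
      have h2Rsq : ∀ {q gq : ℝ}, q ^ 2 ≤ R ^ 2 * gq → gq ≤ 2 → |q| ≤ 2 * R := by
        intro q gq hq hgq
        have h4 : q ^ 2 ≤ (2 * R) ^ 2 := by nlinarith [sq_nonneg R]
        exact (Real.abs_le_sqrt h4).trans_eq (Real.sqrt_sq (by linarith))
      obtain ⟨hbk, hbk'⟩ := hbox s hsI k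
      obtain ⟨hbk1, hbk1'⟩ := hbox s hsI k1
      have hL := FSAssembly.abs_bondCurrent_sub_le (ω₂ := ω₂) (lam := lam) (γ := γ) hβ.le k hk h2R z z'
        (h2Rsq hbk hgk) (h2Rsq hbk1 hgk1) (h2Rsq hbk' hgk) (h2Rsq hbk1' hgk1)
      -- the two propagation bounds, summed: u_k + u_{k+1} ≤ 8|p_{i₀}| (1/2)^D
      have hhalf : ∀ {m : ℕ}, D ≤ m → (1 / 2 : ℝ) ^ m ≤ (1 / 2) ^ D := fun hm =>
        pow_le_pow_of_le_one (by norm_num) (by norm_num) hm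
      have hsum : |z'.1 k - z.1 k| + |z'.2 k - z.2 k| + |z'.1 k1 - z.1 k1| + |z'.2 k1 - z.2 k1| ≤
          8 * |x.2 i₀| * (1 / 2) ^ D := by
        have h1 : |z'.1 k - z.1 k| + |z'.2 k - z.2 k| ≤ 2 * (2 * |x.2 i₀|) * (1 / 2) ^ D :=
          huk.trans (mul_le_mul_of_nonneg_left (hhalf hDk) (by positivity))
        have h2 : |z'.1 k1 - z.1 k1| + |z'.2 k1 - z.2 k1| ≤ 2 * (2 * |x.2 i₀|) * (1 / 2) ^ D :=
          huk1.trans (mul_le_mul_of_nonneg_left (hhalf hDk1'') (by positivity))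
        linarith
      have hfac0 : 0 ≤ 7 * (1 + β) * (2 * R) ^ 3 * (1 + |z.2 k| + |z.2 k1|) := by positivity
      have hmain : |P.bondCurrent N k z' - P.bondCurrent N k z| ≤
          7 * (1 + β) * (2 * R) ^ 3 * (8 * |x.2 i₀|) * (1 / 2) ^ D * (1 + |z.2 k| + |z.2 k1|) := by
        calc |P.bondCurrent N k z' - P.bondCurrent N k z|
            ≤ 7 * (1 + β) * (2 * R) ^ 3 * (1 + |z.2 k| + |z.2 k1|) *
                (|z'.1 k - z.1 k| + |z'.2 k - z.2 k| + |z'.1 k1 - z.1 k1| + |z'.2 k1 - z.2 k1|) := hL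
          _ ≤ 7 * (1 + β) * (2 * R) ^ 3 * (1 + |z.2 k| + |z.2 k1|) * (8 * |x.2 i₀| * (1 / 2) ^ D) :=
              mul_le_mul_of_nonneg_left hsum hfac0
          _ = _ := by ring
      have main : (P.bondCurrent N k z' - P.bondCurrent N k z) ^ 2 ≤
          (7 * (1 + β) * (2 * R) ^ 3 * (8 * |x.2 i₀|) * (1 / 2) ^ D) ^ 2 * (1 + |z.2 k| + |z.2 k1|) ^ 2 := by
        have hrhs0 : 0 ≤ 7 * (1 + β) * (2 * R) ^ 3 * (8 * |x.2 i₀|) * (1 / 2) ^ D * (1 + |z.2 k| + |z.2 k1|) := by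
          positivity
        calc (P.bondCurrent N k z' - P.bondCurrent N k z) ^ 2 = |P.bondCurrent N k z' - P.bondCurrent N k z| ^ 2 :=
              (sq_abs _).symm
          _ ≤ (7 * (1 + β) * (2 * R) ^ 3 * (8 * |x.2 i₀|) * (1 / 2) ^ D * (1 + |z.2 k| + |z.2 k1|)) ^ 2 :=
              pow_le_pow_left₀ (abs_nonneg _) hmain 2
          _ = _ := by ring
      -- rewrite the estimate as `d * (p_{i₀}² (1+|p_k|+|p_{k+1}|)²)` and dominate by `d g₁ + d g₂`
      have hW : (7 * (1 + β) * (2 * R) ^ 3 * (8 * |x.2 i₀|) * (1 / 2) ^ D) ^ 2 * (1 + |z.2 k| + |z.2 k1|) ^ 2 ≤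
          d * g₁ x + d * g₂ z := by
        simp only [hd, hg₁, hg₂]
        have hp2 : |x.2 i₀| ^ 2 = (x.2 i₀) ^ 2 := sq_abs _
        set S := 1 + |z.2 k| + |z.2 k1| with hS
        have hS0 : 0 ≤ S := by positivity
        set c := 448 * (1 + β) * R ^ 3 * (1 / 2) ^ D with hc
        have e1 : (7 * (1 + β) * (2 * R) ^ 3 * (8 * |x.2 i₀|) * (1 / 2) ^ D) ^ 2 * S ^ 2 =
            c ^ 2 * ((x.2 i₀) ^ 2 * S ^ 2) := by
          rw [← hp2]; simp only [hc]; ring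
        rw [e1]
        have hyoung : (x.2 i₀) ^ 2 * S ^ 2 ≤ (x.2 i₀) ^ 4 / 2 + S ^ 4 / 2 := by
          nlinarith [sq_nonneg ((x.2 i₀) ^ 2 - S ^ 2)]
        have := mul_le_mul_of_nonneg_left hyoung (sq_nonneg c)
        simpa only [hS, mul_add] using this
      have hreal : (J' (x, ω) - J (x, ω)) ^ 2 ≤ d * g₁ x + d * g₂ (P.solMap N T T s x (pairPath ω)) := by
        simp only [hJ, hJ']
        rw [hsol x s, hsol (momentumFlip i₀ x) s]
        exact main.trans hW
      have h1 : F (x, ω) ≤ G₁ (x, ω) := by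
        simp only [hF, hG₁]
        calc ENNReal.ofReal ((J' (x, ω) - J (x, ω)) ^ 2)
            ≤ ENNReal.ofReal (d * g₁ x + d * g₂ (P.solMap N T T s x (pairPath ω))) := ENNReal.ofReal_le_ofReal hreal
          _ ≤ ENNReal.ofReal (d * g₁ x) + ENNReal.ofReal (d * g₂ (P.solMap N T T s x (pairPath ω))) :=
              ENNReal.ofReal_add_le
      exact h1.trans le_self_add
  ------------------------------------------------------------------
  -- Step 2: integrate; pass to the product measure
  ------------------------------------------------------------------
  set π : Measure (PhaseSpace N × WienerPair) := μ.prod wienerPair with hπ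
  haveI hπP : IsProbabilityMeasure π := by rw [hπ]; infer_instance
  have hiter : ∀ {G : PhaseSpace N × WienerPair → ℝ≥0∞}, Measurable G →
      ∫⁻ x, ∫⁻ ω, G (x, ω) ∂wienerPair ∂μ = ∫⁻ q, G q ∂π := by
    intro G hG
    exact (lintegral_prod G hG.aemeasurable).symm
  have hsplit : ∫⁻ x, ∫⁻ ω, F (x, ω) ∂wienerPair ∂μ ≤ ∫⁻ q, G₁ q ∂π + ∫⁻ q, G₂ q ∂π := by
    calc ∫⁻ x, ∫⁻ ω, F (x, ω) ∂wienerPair ∂μ = ∫⁻ q, F q ∂π := hiter hFm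
      _ ≤ ∫⁻ q, (G₁ q + G₂ q) ∂π := lintegral_mono hdom
      _ = ∫⁻ q, G₁ q ∂π + ∫⁻ q, G₂ q ∂π := lintegral_add_left hG₁m _
  ------------------------------------------------------------------
  -- Step 3: the two terms
  ------------------------------------------------------------------
  have hT1 : ∫⁻ q, G₁ q ∂π ≤ ENNReal.ofReal (d * (195 * T ^ 2 + 32)) :=
    FSAssembly.lintegral_weight_le hω hl hβ hγ hT hN0 i₀ k k1 hd0 s
  have hB₁ : μ B₁ ≤ ENNReal.ofReal b₁ :=
    pinnedChain_gibbsMeasure_exists_sq_position_gt_le hω hl.le hβ.le hT i₀ hRpos hD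
  have hEπ : π E ≤ ENNReal.ofReal b₂ :=
    pinnedChain_prob_exists_timeIntegral_momentum_sq_gt_le hω hl.le hβ.le hγ.le hT hN0 i₀ hRpos ht hD
  have hπBAD : π BAD ≤ ENNReal.ofReal (b₁ + 2 * b₂) := FSAssembly.measure_bad_le P N T i₀ hB₁m hEm hb₁0 hb₂0 hB₁ hEπ
  have h44 := FSAssembly.lintegral_current_four_le hω hl hβ hγ hT hN0 i₀ k hD2 s
  have hT2 : ∫⁻ q, G₂ q ∂π ≤ ENNReal.ofReal (4 * Real.sqrt (C₄ * (b₁ + 2 * b₂))) := by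
    have hm1 : Measurable fun q => BAD.indicator (fun _ => (1 : ℝ≥0∞)) q * ENNReal.ofReal (J' q ^ 2) :=
      hindm.mul (ENNReal.measurable_ofReal.comp (hJ'm.pow_const 2))
    have hm2 : Measurable fun q => BAD.indicator (fun _ => (1 : ℝ≥0∞)) q * ENNReal.ofReal (J q ^ 2) :=
      hindm.mul (ENNReal.measurable_ofReal.comp (hJm.pow_const 2))
    have hb : 0 ≤ b₁ + 2 * b₂ := by positivity
    have hH1 := FSAssembly.lintegral_indicator_sq_le_sqrt π hJ'm hBADm hC₄ hb h44.2 hπBAD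
    have hH2 := FSAssembly.lintegral_indicator_sq_le_sqrt π hJm hBADm hC₄ hb h44.1 hπBAD
    have hm1' : Measurable fun q => 2 * (BAD.indicator (fun _ => (1 : ℝ≥0∞)) q * ENNReal.ofReal (J' q ^ 2)) :=
      hm1.const_mul 2
    calc ∫⁻ q, G₂ q ∂π = 2 * ∫⁻ q, BAD.indicator (fun _ => (1 : ℝ≥0∞)) q * ENNReal.ofReal (J' q ^ 2) ∂π +
          2 * ∫⁻ q, BAD.indicator (fun _ => (1 : ℝ≥0∞)) q * ENNReal.ofReal (J q ^ 2) ∂π := by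
          simp only [hG₂]
          rw [lintegral_add_left hm1', lintegral_const_mul 2 hm1, lintegral_const_mul 2 hm2]
      _ ≤ 2 * ENNReal.ofReal (Real.sqrt (C₄ * (b₁ + 2 * b₂))) + 2 * ENNReal.ofReal (Real.sqrt (C₄ * (b₁ + 2 * b₂))) :=
          add_le_add (mul_le_mul' le_rfl hH1) (mul_le_mul' le_rfl hH2)
      _ = ENNReal.ofReal (4 * Real.sqrt (C₄ * (b₁ + 2 * b₂))) := by
          rw [← two_mul, ← mul_assoc, ← ENNReal.ofReal_ofNat 2, ← ENNReal.ofReal_mul (by norm_num),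
            ← ENNReal.ofReal_mul (by norm_num)]
          congr 1; ring
  -- conclusion
  calc ∫⁻ x, ∫⁻ ω, F (x, ω) ∂wienerPair ∂μ ≤ ∫⁻ q, G₁ q ∂π + ∫⁻ q, G₂ q ∂π := hsplit
    _ ≤ ENNReal.ofReal (d * (195 * T ^ 2 + 32)) + ENNReal.ofReal (4 * Real.sqrt (C₄ * (b₁ + 2 * b₂))) :=
        add_le_add hT1 hT2

end SingleFlip


/-- **Registered sub-goal `stub_coneSingleFlipEstimate`** (leaf (C) of S4, line `loomis-compact-horizon-witness`):
the `N`-uniform single-flip estimate of the synchronous coupling with distance-growing boxes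
(`single_flip_estimate_cone`, closed form). [folklore] -/
theorem stub_coneSingleFlipEstimate :
    ∀ ω₂ lam β γ : ℝ, 0 < ω₂ → 0 < lam → 0 < β → 0 < γ → ∀ (N : ℕ) (T : ℝ), 0 < T →
      ∀ (i₀ k : Fin N) (hk : k.val + 1 < N) (D : ℕ), 1 ≤ D →
        D ≤ ((k : ℤ) - (i₀ : ℤ)).natAbs → ((k : ℤ) - (i₀ : ℤ)).natAbs ≤ D + 1 →
        D ≤ ((k : ℤ) + 1 - (i₀ : ℤ)).natAbs → ((k : ℤ) + 1 - (i₀ : ℤ)).natAbs ≤ D + 1 →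
        ∀ (R t C₄ : ℝ), 1 ≤ R → 0 ≤ t → 0 ≤ C₄ →
        12 * Real.exp 1 * (2 * ((3 + ω₂ + 3 * lam + 24 * β + 2 * γ) * R ^ 2)) * t ≤ D →
        (MeasureTheory.Integrable (fun x => (Literature.MathematicalPhysics.KineticTheory.HeatConduction.pinnedChain ω₂ lam β γ).bondCurrent N k x ^ 4)
            ((Literature.MathematicalPhysics.KineticTheory.HeatConduction.pinnedChain ω₂ lam β γ).gibbsMeasure N T) ∧
          ∫ x, (Literature.MathematicalPhysics.KineticTheory.HeatConduction.pinnedChain ω₂ lam β γ).bondCurrent N k x ^ 4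
            ∂((Literature.MathematicalPhysics.KineticTheory.HeatConduction.pinnedChain ω₂ lam β γ).gibbsMeasure N T) ≤ C₄) →
        ∀ s : NNReal, (s : ℝ) ≤ t →
          ∫⁻ x, ∫⁻ ω, ENNReal.ofReal
              (((Literature.MathematicalPhysics.KineticTheory.HeatConduction.pinnedChain ω₂ lam β γ).bondCurrent N k
                  ((Literature.MathematicalPhysics.KineticTheory.HeatConduction.pinnedChain ω₂ lam β γ).solMap N T T s
                    (Literature.MathematicalPhysics.KineticTheory.HeatConduction.momentumFlip i₀ x)
                    (Literature.Probability.Process.pairPath ω)) -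
                (Literature.MathematicalPhysics.KineticTheory.HeatConduction.pinnedChain ω₂ lam β γ).bondCurrent N k
                  ((Literature.MathematicalPhysics.KineticTheory.HeatConduction.pinnedChain ω₂ lam β γ).solMap N T T s x
                    (Literature.Probability.Process.pairPath ω))) ^ 2)
              ∂Literature.Probability.Process.wienerPair
              ∂((Literature.MathematicalPhysics.KineticTheory.HeatConduction.pinnedChain ω₂ lam β γ).gibbsMeasure N T) ≤
            ENNReal.ofReal ((448 * (1 + β) * R ^ 3 * (1 / 2) ^ D) ^ 2 * (195 * T ^ 2 + 32)) +
              ENNReal.ofReal (4 * Real.sqrt (C₄ *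
                (7 * D * (((∫⁻ a, ENNReal.ofReal (a ^ 16) *
                      ENNReal.ofReal (Real.exp (-(Literature.MathematicalPhysics.KineticTheory.HeatConduction.pinnedChain
                        ω₂ lam β γ).U a / T))) /
                    ∫⁻ a, ENNReal.ofReal (Real.exp (-(Literature.MathematicalPhysics.KineticTheory.HeatConduction.pinnedChain
                        ω₂ lam β γ).U a / T))).toReal * 4 ^ 8 / R ^ 16) +
                  2 * (7 * D * (2027025 * T ^ 8 * 4 ^ 8 * t ^ 16 / R ^ 16))))) :=
  fun _ _ _ _ hω hl hβ hγ _ _ hT i₀ k hk _ hD hDk hDk' hDk1 hDk1' _ _ _ hR ht hC₄ hreg hD2 s hs =>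
    single_flip_estimate_cone hω hl hβ hγ hT i₀ k hk hD hDk hDk' hDk1 hDk1' hR ht hC₄ hreg hD2 s hs

end Summit.AtomisticToContinuum.FouriersLaw.Theorems.AbelThermodynamicLimit.LoomisCompactHorizonWitness

end
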